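import Summits.AnomalousDissipation.AnomalousDissipation.Theses.TaylorCertificates
import Summits.AnomalousDissipation.AnomalousDissipation.Theorems.TaylorCertificatePair.Negative.Bounds
import Summits.AnomalousDissipation.AnomalousDissipation.Theorems.KolmogorovFloorEnsembleCeiling.Negative.DodgerTools

/-!
# Truncated dodgers, the per-force Kolmogorov floor datum, and the first lemma (negative side of
# `KolmogorovFloorEnsembleCeiling`, stmt-AnomalousDissipation-14183)

Line lead `prover-line-stmt-AnomalousDissipation-14183-0` (2026-08-16). Part 1/3 of the kernel-checked form of the paper
theorem `FloorWitnessForcesDodgerRoughness` of the crux card `Cruxes/KolmogorovFloor/Ideas/truncated-euler-k41-hot.md`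
(crux 14030, gen-2 ideator 1; its first lemma was proved in `Cruxes/KolmogorovFloor/SketchIdeator1G2.lean`), used as
the FLOOR jaw of the two-adversary pincer of crux 14183 (the pair `KolmogorovFloorEnsembleCeiling` is
`∃ f adm, ∃ consts, ∀ ν < ν₀, KolmogorovFloorDatumAt f ε₀ C Θ ν ∧ ceiling`). Self-contained over
`Theses.TaylorCertificates` + `TaylorCertificatePair/Negative/Bounds` (the route's rev-13 drop of
`KolmogorovFloor`/`FloorCertificate`/`EnsembleCeiling` orphaned `Negative/SameForce` and
`FloorCertificate/Negative/WeakDuality`, so the per-state floor inequality and the floor-at-rest lemma are restated).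

* `IsTruncatedEulerSteady N' f a` — a TRUNCATED DODGER: an exact steady state of the level-`N'` Galerkin–Euler system
  of `f`; `CheapDodgers f` — the adversary: dodgers at arbitrarily high levels with SUB-KOLMOGOROV enstrophy
  `‖∇a‖² ≤ δ N'^{4/3}` and energy `≤ δ N'^{8/3}`, every `δ > 0`;
* `FloorIneqAt`, `KolmogorovFloorDatumAt`, `floorDatum_of_pair` — the floor conjunct of the crux, per state / per `ν`;
* `floorIneqAt_at_rest`, `force_ne_zero_of_floorDatum` — at rest only the injection survives, so `f ≠ 0`;
* `dodger_identities` — FIRST LEMMA: against a band-limited admissible multiplier the injection and the inertial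
  term cancel and the force does no work;
* `exists_state_of_smooth`, `floorIneq_at_rep` — the floor inequality written on a smooth representative;
* the sign-averaging algebra of the two test states `a ± t w` (`inertial_sum_pm`, `linear_sum_pm`,
  `integral_inner_add_smul`, `testState_regular`) and the multiplicative cube-root dictionary `cubeRoot_products`.

Imports are kept to modules built from their current sources on the hub (`Theses.TaylorCertificates`,
`TaylorCertificatePair/Negative/Bounds`, `Negative/DodgerTools`); every Theorems module whose closure contains
`FloorCertificate/Negative/WeakDuality` (unbuildable at HEAD since the rev-13 route edit, e.g. `KolmogorovFloor/Negative/FarField`)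
is avoided, and the regularity of the test states is proved from `∂ᵢ`-linearity directly. The kill itself is `Negative/CheapDodgers.lean` (via `Negative/DodgerSum.lean`). Nothing here asserts a Theses statement.
-/


noncomputable section

open MeasureTheory UnitAddTorus
open scoped InnerProductSpace ENNReal

namespace Summit.AnomalousDissipation.AnomalousDissipation.Theorems.KolmogorovFloorEnsembleCeiling.Negative

open Literature.Analysis.FunctionSpaces Literature.Analysis.FunctionSpaces.Torus Literature.Analysis.FluidPDE
open Summit.AnomalousDissipation.AnomalousDissipation.Theses.TaylorCertificates
open Summit.AnomalousDissipation.AnomalousDissipation.Theorems.TaylorCertificatePair.Negative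

/-! ## Truncated dodgers and the first lemma -/

/-- A TRUNCATED DODGER of `f` at level `N'`: an exact steady state of the Galerkin–Euler system
`P_{N'} P[(a·∇)a] = P_{N'} f` — a smooth divergence-free mean-zero field with `P_{N'} a = a` whose Euler residual
`(a·∇)a − f` is orthogonal to every smooth divergence-free mean-zero field `w` with `P_{N'} w = w`
(card `truncated-euler-k41-hot`; verbatim `Cruxes/KolmogorovFloor/SketchIdeator1G2.lean`). -/
def IsTruncatedEulerSteady (N' : ℕ) (f a : UnitAddTorus (Fin 3) → EuclideanSpace ℝ (Fin 3)) : Prop :=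
  IsSmooth a ∧ IsDivFree a ∧ HasZeroMean a ∧ fourierTruncate N' a = a ∧
    ∀ w : UnitAddTorus (Fin 3) → EuclideanSpace ℝ (Fin 3), IsSmooth w → IsDivFree w → HasZeroMean w →
      fourierTruncate N' w = w → ∫ x, ⟪convect a a x - f x, w x⟫_ℝ = 0

/-- CHEAP DODGERS for the force `f` (the adversary of the Kolmogorov-class floor): for every `δ > 0` there are
truncated dodgers at arbitrarily high levels `N'` with sub-Kolmogorov enstrophy `‖∇a‖₂² ≤ δ N'^{4/3}` and energy
`∫‖a‖² ≤ δ N'^{8/3}` (any bounded-energy family with `‖∇a_{N'}‖₂ = o(N'^{2/3})` qualifies). -/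
def CheapDodgers (f : UnitAddTorus (Fin 3) → EuclideanSpace ℝ (Fin 3)) : Prop :=
  ∀ δ : ℝ, 0 < δ → ∀ N₀ : ℕ, ∃ N' : ℕ, N₀ ≤ N' ∧ ∃ a : UnitAddTorus (Fin 3) → EuclideanSpace ℝ (Fin 3),
    IsTruncatedEulerSteady N' f a ∧ (∫ x, ‖a x‖ ^ 2) ≤ δ * (N' : ℝ) ^ (8 / 3 : ℝ) ∧
      gradNormSq a ≤ δ * (N' : ℝ) ^ (4 / 3 : ℝ)

/-- The FLOOR inequality of the crux at one state `u ∈ H` (verbatim the body of the crux after `∀ u`, with the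
three `let`s substituted): `‖∇u‖ < ∞ → |u|² ≤ 16‖f‖²/ν² → ε₀ ≤ ν‖∇u‖² + ⟨F(u), Φ₁'(u)⟩ + 2θ₁((u,f) − ν‖∇u‖²)`.
(Character-identical to `FloorCertificate/Negative/WeakDuality.FloorIneq`, whose module the rev-13 route edit broke.) -/
def FloorIneqAt (ν : ℝ) (f : UnitAddTorus (Fin 3) → EuclideanSpace ℝ (Fin 3)) (Φ₁ : Torus.CylindricalTest (Fin 3))
    (θ₁ ε₀ : ℝ) (u : Torus.energySpace (Fin 3)) : Prop :=
  Torus.eGradNormSq ((u : Lp (EuclideanSpace ℝ (Fin 3)) 2 (volume : Measure (UnitAddTorus (Fin 3)))) :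
      UnitAddTorus (Fin 3) → EuclideanSpace ℝ (Fin 3)) ≠ ⊤ → ‖u‖ ^ 2 ≤ 16 * (∫ x, ‖f x‖ ^ 2) / ν ^ 2 →
    ε₀ ≤ ν * (Torus.eGradNormSq ((u : Lp (EuclideanSpace ℝ (Fin 3)) 2 (volume : Measure (UnitAddTorus (Fin 3)))) :
        UnitAddTorus (Fin 3) → EuclideanSpace ℝ (Fin 3))).toReal + Torus.nsGeneratorPairing ν f u (Φ₁.grad u) +
      2 * θ₁ * (Torus.pairing (u : Lp (EuclideanSpace ℝ (Fin 3)) 2 (volume : Measure (UnitAddTorus (Fin 3)))) f -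
        ν * (Torus.eGradNormSq ((u : Lp (EuclideanSpace ℝ (Fin 3)) 2 (volume : Measure (UnitAddTorus (Fin 3)))) :
          UnitAddTorus (Fin 3) → EuclideanSpace ℝ (Fin 3))).toReal)

/-- The Kolmogorov-class FLOOR DATUM of the force `f` with constants `ε₀, C, Θ` at viscosity `ν` (verbatim the first
conjunct of the `∀ ν`-body of the crux `KolmogorovFloorEnsembleCeiling`): a resolution `N ≤ Cν^{-3/4}`, a cylindrical
`Φ₁` with test fields of degree `≤ N`, a weight `θ₁ ∈ [−Θ, 0]`, and the floor inequality at every state. -/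
def KolmogorovFloorDatumAt (f : UnitAddTorus (Fin 3) → EuclideanSpace ℝ (Fin 3)) (ε₀ C Θ ν : ℝ) : Prop :=
  ∃ (N : ℕ) (Φ₁ : Torus.CylindricalTest (Fin 3)) (θ₁ : ℝ), (N : ℝ) ≤ C * ν ^ (-(3 / 4 : ℝ)) ∧
    (∀ i, fourierTruncate N (Φ₁.g i) = Φ₁.g i) ∧ -Θ ≤ θ₁ ∧ θ₁ ≤ 0 ∧
      ∀ u : Torus.energySpace (Fin 3), FloorIneqAt ν f Φ₁ θ₁ ε₀ u

/-- The crux hands every `ν ∈ (0, ν₀)` a floor datum of its force (definitional projection). -/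
theorem floorDatum_of_pair (h : KolmogorovFloorEnsembleCeiling) :
    ∃ f : UnitAddTorus (Fin 3) → EuclideanSpace ℝ (Fin 3), IsSmooth f ∧ IsDivFree f ∧ HasZeroMean f ∧
      ∃ (ε₀ C Θ ν₀ : ℝ), 0 < ε₀ ∧ 0 < ν₀ ∧ ∀ ν : ℝ, 0 < ν → ν < ν₀ → KolmogorovFloorDatumAt f ε₀ C Θ ν := by
  obtain ⟨f, hfs, hfd, hfz, ε₀, C, Θ, E, ν₀, hε₀, hν₀, hall⟩ := h
  exact ⟨f, hfs, hfd, hfz, ε₀, C, Θ, ν₀, hε₀, hν₀, fun ν hν hνν₀ => (hall ν hν hνν₀).1⟩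

/-- **The floor at rest**: at `u = 0` only the injection survives, `ε₀ ≤ (f, Φ₁'(0))`. -/
theorem floorIneqAt_at_rest {ν : ℝ} (hν : 0 < ν) {f : UnitAddTorus (Fin 3) → EuclideanSpace ℝ (Fin 3)}
    {Φ₁ : Torus.CylindricalTest (Fin 3)} {θ₁ ε₀ : ℝ} (h : FloorIneqAt ν f Φ₁ θ₁ ε₀ 0) :
    ε₀ ≤ ∫ x, ⟪f x, Φ₁.grad 0 x⟫_ℝ := by
  have h1 : Torus.eGradNormSq (((0 : Torus.energySpace (Fin 3)) : Lp (EuclideanSpace ℝ (Fin 3)) 2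
      (volume : Measure (UnitAddTorus (Fin 3)))) : UnitAddTorus (Fin 3) → EuclideanSpace ℝ (Fin 3)) ≠ ⊤ := by
    rw [eGradNormSq_coe_zero]; exact ENNReal.zero_ne_top
  have h2 : ‖(0 : Torus.energySpace (Fin 3))‖ ^ 2 ≤ 16 * (∫ x, ‖f x‖ ^ 2) / ν ^ 2 := by
    rw [norm_zero, zero_pow two_ne_zero]
    have : 0 ≤ ∫ x, ‖f x‖ ^ 2 := integral_nonneg fun x => by positivity
    positivity
  have h3 := h h1 h2
  rw [nsGeneratorPairing_of_ae coe_zero_ae, pairing_of_ae coe_zero_ae, eGradNormSq_coe_zero] at h3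
  simpa using h3

/-- **A vanishing force carries no floor datum** (`ε₀ > 0`): at rest every term vanishes. -/
theorem force_ne_zero_of_floorDatum {f : UnitAddTorus (Fin 3) → EuclideanSpace ℝ (Fin 3)} (hf : IsSmooth f)
    {ε₀ C Θ ν : ℝ} (hε₀ : 0 < ε₀) (hν : 0 < ν) (h : KolmogorovFloorDatumAt f ε₀ C Θ ν) : 0 < ∫ x, ‖f x‖ ^ 2 := by
  have hF2nn : 0 ≤ ∫ x, ‖f x‖ ^ 2 := integral_nonneg fun x => by positivity
  refine lt_of_le_of_ne hF2nn fun hF0 => ?_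
  obtain ⟨N, Φ₁, θ₁, -, -, -, -, hu⟩ := h
  have hrest := floorIneqAt_at_rest hν (hu 0)
  have hzero : (∫ x, ⟪f x, Φ₁.grad 0 x⟫_ℝ) = 0 := by
    rw [← integral_zero (α := UnitAddTorus (Fin 3)) (G := ℝ)]
    refine integral_congr_ae ?_
    filter_upwards [ae_zero_of_integral_sq_zero hf hF0.symm] with x hx
    simp [hx]
  linarith

/-- Smooth fields have finite spectral enstrophy. -/
theorem eGradNormSq_ne_top_of_smooth' {v : UnitAddTorus (Fin 3) → EuclideanSpace ℝ (Fin 3)} (hv : IsSmooth v) :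
    Torus.eGradNormSq v ≠ ⊤ :=
  (hv.memSobolev_one_complexify.eGradNormSq_lt_top).ne

/-- **First lemma** (card `truncated-euler-k41-hot`). At a truncated dodger `a` of level `N'`, for every smooth
divergence-free mean-zero `W` with `P_{N'} W = W`: the injection and the inertial term cancel,
`(f, W) + ∫ ⟪DW·a, a⟫ = 0` (test the truncated equation with `W`, antisymmetry of the trilinear form), and the
force does no work, `(a, f) = 0` (test with `a`, `((a·∇)a, a) = 0`). -/
theorem dodger_identities {N' : ℕ} {f a W : UnitAddTorus (Fin 3) → EuclideanSpace ℝ (Fin 3)} (hf : IsSmooth f)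
    (ha : IsTruncatedEulerSteady N' f a) (hWs : IsSmooth W) (hWd : IsDivFree W) (hWz : HasZeroMean W)
    (hWb : fourierTruncate N' W = W) :
    (∫ x, ⟪f x, W x⟫_ℝ) + ∫ x, ⟪Torus.fderiv W x (a x), a x⟫_ℝ = 0 ∧ ∫ x, ⟪a x, f x⟫_ℝ = 0 := by
  obtain ⟨has, had, haz, hab, hsteady⟩ := ha
  constructor
  · have h1 : ∫ x, ⟪Torus.fderiv W x (a x), a x⟫_ℝ = -∫ x, ⟪f x, W x⟫_ℝ := by
      have e1 : (fun x => ⟪Torus.fderiv W x (a x), a x⟫_ℝ) = fun x => ⟪convect a W x, a x⟫_ℝ := rfl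
      rw [e1, integral_inner_convect_eq_neg has had hWs has]
      have e2 := hsteady W hWs hWd hWz hWb
      have hint1 : Integrable (fun x => ⟪convect a a x, W x⟫_ℝ) volume := ((has.convect has).inner hWs).integrable
      have hint2 : Integrable (fun x => ⟪f x, W x⟫_ℝ) volume := (hf.inner hWs).integrable
      have e3 : ∫ x, ⟪convect a a x - f x, W x⟫_ℝ = (∫ x, ⟪convect a a x, W x⟫_ℝ) - ∫ x, ⟪f x, W x⟫_ℝ := by
        simp_rw [inner_sub_left]
        exact integral_sub hint1 hint2
      have e4 : ∫ x, ⟪W x, convect a a x⟫_ℝ = ∫ x, ⟪convect a a x, W x⟫_ℝ :=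
        integral_congr_ae (ae_of_all _ fun x => real_inner_comm _ _)
      rw [e4]
      linarith
    rw [h1]
    ring
  · have e2 := hsteady a has had haz hab
    have hself : ∫ x, ⟪convect a a x, a x⟫_ℝ = 0 := integral_inner_convect_self_eq_zero has had
    have hint1 : Integrable (fun x => ⟪convect a a x, a x⟫_ℝ) volume := ((has.convect has).inner has).integrable
    have hint2 : Integrable (fun x => ⟪f x, a x⟫_ℝ) volume := (hf.inner has).integrable
    have e3 : ∫ x, ⟪convect a a x - f x, a x⟫_ℝ = (∫ x, ⟪convect a a x, a x⟫_ℝ) - ∫ x, ⟪f x, a x⟫_ℝ := by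
      simp_rw [inner_sub_left]
      exact integral_sub hint1 hint2
    have e5 : ∫ x, ⟪a x, f x⟫_ℝ = ∫ x, ⟪f x, a x⟫_ℝ := integral_congr_ae (ae_of_all _ fun x => real_inner_comm _ _)
    rw [e5]
    linarith

/-! ## States of `H` represented by smooth fields, and the floor inequality on a representative -/

/-- A smooth divergence-free mean-zero field represents a state of `H`. -/
theorem exists_state_of_smooth {v : UnitAddTorus (Fin 3) → EuclideanSpace ℝ (Fin 3)} (hv : IsSmooth v)
    (hd : IsDivFree v) (hz : HasZeroMean v) :
    ∃ u : Torus.energySpace (Fin 3),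
      ((u : Lp (EuclideanSpace ℝ (Fin 3)) 2 (volume : Measure (UnitAddTorus (Fin 3)))) :
        UnitAddTorus (Fin 3) → EuclideanSpace ℝ (Fin 3)) =ᵐ[volume] v :=
  ⟨⟨(hv.memLp 2).toLp v, smoothSolenoidal_subset_energySpace ⟨v, hv, hd, hz, MemLp.coeFn_toLp _⟩⟩,
    (hv.memLp 2).coeFn_toLp⟩

/-- The floor inequality at a state represented by a smooth field `v` inside the Leray ball, with every term
written on the representative: `ε₀ ≤ (1 − 2θ₁) ν ‖∇v‖² + [(f, W) + ν (v, ΔW) + ∫⟪DW·v, v⟫] + 2θ₁ (v, f)`,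
`W = Φ₁'(u)`. -/
theorem floorIneq_at_rep {ν : ℝ} {f v : UnitAddTorus (Fin 3) → EuclideanSpace ℝ (Fin 3)} (hv : IsSmooth v)
    {Φ₁ : Torus.CylindricalTest (Fin 3)} {θ₁ ε₀ : ℝ} {u : Torus.energySpace (Fin 3)}
    (hu : ((u : Lp (EuclideanSpace ℝ (Fin 3)) 2 (volume : Measure (UnitAddTorus (Fin 3)))) :
      UnitAddTorus (Fin 3) → EuclideanSpace ℝ (Fin 3)) =ᵐ[volume] v)
    (h : FloorIneqAt ν f Φ₁ θ₁ ε₀ u) (hball : ∫ x, ‖v x‖ ^ 2 ≤ 16 * (∫ x, ‖f x‖ ^ 2) / ν ^ 2) :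
    ε₀ ≤ (1 - 2 * θ₁) * (ν * gradNormSq v) +
      ((∫ x, ⟪f x, Φ₁.grad u x⟫_ℝ) + ν * (∫ x, ⟪v x, laplacian (Φ₁.grad u) x⟫_ℝ) +
        ∫ x, ⟪Torus.fderiv (Φ₁.grad u) x (v x), v x⟫_ℝ) + 2 * θ₁ * ∫ x, ⟪v x, f x⟫_ℝ := by
  have hfin : eGradNormSq ((u : Lp (EuclideanSpace ℝ (Fin 3)) 2 (volume : Measure (UnitAddTorus (Fin 3)))) :
      UnitAddTorus (Fin 3) → EuclideanSpace ℝ (Fin 3)) ≠ ⊤ := by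
    rw [eGradNormSq_congr_ae' hu]; exact eGradNormSq_ne_top_of_smooth' hv
  have hnorm : ‖u‖ ^ 2 ≤ 16 * (∫ x, ‖f x‖ ^ 2) / ν ^ 2 := by rw [norm_sq_of_ae hu]; exact hball
  have hfl := h hfin hnorm
  rw [nsGeneratorPairing_of_ae hu, pairing_of_ae hu, eGradNormSq_congr_ae' hu,
    ← gradNormSq_eq_toReal_eGradNormSq_holds hv] at hfl
  linarith

/-! ## The two test states `a ± t ŵ`: averaging over the sign kills the odd terms -/

/-- Pointwise: `⟪L(p + tq), p + tq⟫ + ⟪L(p − tq), p − tq⟫ = 2⟪Lp, p⟫ + 2t²⟪Lq, q⟫` for a linear `L`. -/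
theorem inner_apply_add_smul_add_sub_smul (L : EuclideanSpace ℝ (Fin 3) →L[ℝ] EuclideanSpace ℝ (Fin 3))
    (p q : EuclideanSpace ℝ (Fin 3)) (t : ℝ) :
    ⟪L (p + t • q), p + t • q⟫_ℝ + ⟪L (p + (-t) • q), p + (-t) • q⟫_ℝ = 2 * ⟪L p, p⟫_ℝ + 2 * t ^ 2 * ⟪L q, q⟫_ℝ := by
  simp only [map_add, map_smul, inner_add_left, inner_add_right, inner_smul_left, inner_smul_right, conj_trivial]
  ring

/-- The sign-averaged inertial term: `∫⟪DW(a+tw), a+tw⟫ + ∫⟪DW(a−tw), a−tw⟫ = 2∫⟪DW a, a⟫ + 2t²∫⟪DW w, w⟫`. -/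
theorem inertial_sum_pm {a w W : UnitAddTorus (Fin 3) → EuclideanSpace ℝ (Fin 3)} (ha : IsSmooth a)
    (hw : IsSmooth w) (hW : IsSmooth W) (t : ℝ) :
    (∫ x, ⟪Torus.fderiv W x ((a + t • w) x), (a + t • w) x⟫_ℝ) +
        ∫ x, ⟪Torus.fderiv W x ((a + (-t) • w) x), (a + (-t) • w) x⟫_ℝ =
      2 * (∫ x, ⟪Torus.fderiv W x (a x), a x⟫_ℝ) + 2 * t ^ 2 * ∫ x, ⟪Torus.fderiv W x (w x), w x⟫_ℝ := by
  have hreg : ∀ s : ℝ, IsSmooth (a + s • w) := fun s => ha.add (hw.smul s)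
  have hint : ∀ {v : UnitAddTorus (Fin 3) → EuclideanSpace ℝ (Fin 3)}, IsSmooth v →
      Integrable (fun x => ⟪Torus.fderiv W x (v x), v x⟫_ℝ) volume :=
    fun hv => ((hv.convect hW).inner hv).integrable
  rw [← integral_add (hint (hreg t)) (hint (hreg (-t))), ← integral_const_mul, ← integral_const_mul,
    ← integral_add ((hint ha).const_mul 2) ((hint hw).const_mul (2 * t ^ 2))]
  refine integral_congr_ae (ae_of_all _ fun x => ?_)
  have h := inner_apply_add_smul_add_sub_smul (Torus.fderiv W x) (a x) (w x) t
  simp only [Pi.add_apply, Pi.smul_apply] at h ⊢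
  linarith [h]

/-- The sign-averaged linear terms: `∫⟪a+tw, g⟫ + ∫⟪a−tw, g⟫ = 2∫⟪a, g⟫` for continuous fields. -/
theorem linear_sum_pm {a w g : UnitAddTorus (Fin 3) → EuclideanSpace ℝ (Fin 3)} (ha : Continuous a)
    (hw : Continuous w) (hg : Continuous g) (t : ℝ) :
    (∫ x, ⟪(a + t • w) x, g x⟫_ℝ) + ∫ x, ⟪(a + (-t) • w) x, g x⟫_ℝ = 2 * ∫ x, ⟪a x, g x⟫_ℝ := by
  have hint : ∀ s : ℝ, Integrable (fun x => ⟪(a + s • w) x, g x⟫_ℝ) volume := fun s =>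
    ((ha.add (hw.const_smul s)).inner hg).integrable_unitAddTorus
  rw [← integral_add (hint t) (hint (-t)), ← integral_const_mul]
  refine integral_congr_ae (ae_of_all _ fun x => ?_)
  simp only [Pi.add_apply, Pi.smul_apply, inner_add_left, inner_smul_left, conj_trivial]
  ring

/-- A single linear term: `∫⟪a + s w, g⟫ = ∫⟪a, g⟫ + s ∫⟪w, g⟫`. -/
theorem integral_inner_add_smul {a w g : UnitAddTorus (Fin 3) → EuclideanSpace ℝ (Fin 3)} (ha : Continuous a)
    (hw : Continuous w) (hg : Continuous g) (s : ℝ) :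
    ∫ x, ⟪(a + s • w) x, g x⟫_ℝ = (∫ x, ⟪a x, g x⟫_ℝ) + s * ∫ x, ⟪w x, g x⟫_ℝ := by
  rw [← integral_const_mul, ← integral_add ((ha.inner hg).integrable_unitAddTorus)
    (((hw.inner hg).integrable_unitAddTorus).const_mul s)]
  refine integral_congr_ae (ae_of_all _ fun x => ?_)
  simp only [Pi.add_apply, Pi.smul_apply, inner_add_left, inner_smul_left, conj_trivial]

/-- Sums `a + s • w` of smooth divergence-free fields are divergence free (componentwise linearity of `∂ᵢ`). -/
theorem isDivFree_add_smul {a w : UnitAddTorus (Fin 3) → EuclideanSpace ℝ (Fin 3)} (ha : IsSmooth a)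
    (had : IsDivFree a) (hw : IsSmooth w) (hwd : IsDivFree w) (s : ℝ) : IsDivFree (a + s • w) := by
  intro x
  have hca : ∀ i : Fin 3, IsContDiff 1 (fun y => a y i) := fun i => (ha.apply i).isContDiff (by simp)
  have hcw : ∀ i : Fin 3, IsContDiff 1 (fun y => w y i) := fun i => (hw.apply i).isContDiff (by simp)
  have hcsw : ∀ i : Fin 3, IsContDiff 1 (s • fun y => w y i) := fun i => ((hw.apply i).smul s).isContDiff (by simp)
  have hcomp : ∀ i : Fin 3, (fun y => (a + s • w) y i) = (fun y => a y i) + s • (fun y => w y i) := by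
    intro i; funext y; simp [smul_eq_mul]
  unfold divergence
  simp_rw [hcomp]
  have hterm : ∀ i : Fin 3, partialDeriv i ((fun y => a y i) + s • fun y => w y i) x =
      partialDeriv i (fun y => a y i) x + s * partialDeriv i (fun y => w y i) x := by
    intro i
    rw [partialDeriv_add (hca i) (hcsw i) i, Pi.add_apply, partialDeriv_const_smul (hcw i) s i, Pi.smul_apply,
      smul_eq_mul]
  simp_rw [hterm]
  rw [Finset.sum_add_distrib, ← Finset.mul_sum]
  have h1 : ∑ i : Fin 3, partialDeriv i (fun y => a y i) x = 0 := had x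
  have h2 : ∑ i : Fin 3, partialDeriv i (fun y => w y i) x = 0 := hwd x
  rw [h1, h2, mul_zero, add_zero]

/-- Sums `a + s • w` of integrable mean-zero fields have zero mean. -/
theorem hasZeroMean_add_smul {a w : UnitAddTorus (Fin 3) → EuclideanSpace ℝ (Fin 3)} (ha : IsSmooth a)
    (haz : HasZeroMean a) (hw : IsSmooth w) (hwz : HasZeroMean w) (s : ℝ) : HasZeroMean (a + s • w) := by
  unfold HasZeroMean at haz hwz ⊢
  have e : (fun x => (a + s • w) x) = fun x => a x + s • w x := by funext x; simp
  have hi : Integrable (fun x => s • w x) volume := (hw.smul s).integrable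
  rw [e, integral_add ha.integrable hi, integral_smul, haz, hwz, smul_zero, add_zero]

/-- Regularity of the test states `a + s • w`. -/
theorem testState_regular {a w : UnitAddTorus (Fin 3) → EuclideanSpace ℝ (Fin 3)} (ha : IsSmooth a)
    (had : IsDivFree a) (haz : HasZeroMean a) (hw : IsSmooth w) (hwd : IsDivFree w) (hwz : HasZeroMean w)
    (s : ℝ) : IsSmooth (a + s • w) ∧ IsDivFree (a + s • w) ∧ HasZeroMean (a + s • w) :=
  ⟨ha.add (hw.smul s), isDivFree_add_smul ha had hw hwd s, hasZeroMean_add_smul ha haz hw hwz s⟩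

/-- The cube-root dictionary, multiplicative part: `x·y = C^{1/3}`, so `(xy)⁴ = C^{4/3}`, `(xy)⁸ = C^{8/3}`,
`(xy)¹² = C⁴`, and `x¹² y⁶ = C⁴ / n²`. -/
theorem cubeRoot_products {C n : ℝ} (hC : 0 < C) (hn : 0 < n) :
    let x : ℝ := (C / n) ^ (1 / 3 : ℝ)
    let y : ℝ := n ^ (1 / 3 : ℝ)
    (x * y) ^ 4 = C ^ (4 / 3 : ℝ) ∧ (x * y) ^ 8 = C ^ (8 / 3 : ℝ) ∧ (x * y) ^ 12 = C ^ 4 ∧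
      x ^ 12 * y ^ 6 = C ^ 4 / n ^ 2 := by
  intro x y
  have hq : 0 < C / n := div_pos hC hn
  have hxy : x * y = C ^ (1 / 3 : ℝ) := by
    show (C / n) ^ (1 / 3 : ℝ) * n ^ (1 / 3 : ℝ) = C ^ (1 / 3 : ℝ)
    rw [← Real.mul_rpow hq.le hn.le, div_mul_cancel₀ C hn.ne']
  have h4 : (x * y) ^ 4 = C ^ (4 / 3 : ℝ) := by
    rw [hxy, ← Real.rpow_natCast, ← Real.rpow_mul hC.le]; norm_num
  have h8 : (x * y) ^ 8 = C ^ (8 / 3 : ℝ) := by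
    rw [hxy, ← Real.rpow_natCast, ← Real.rpow_mul hC.le]; norm_num
  have h12 : (x * y) ^ 12 = C ^ 4 := by
    rw [hxy, ← Real.rpow_natCast, ← Real.rpow_mul hC.le]
    norm_num
  have hx3 : x ^ 3 = C / n := by
    show ((C / n) ^ (1 / 3 : ℝ)) ^ 3 = C / n
    rw [← Real.rpow_natCast, ← Real.rpow_mul hq.le]; norm_num
  have hy3 : y ^ 3 = n := by
    show (n ^ (1 / 3 : ℝ)) ^ 3 = n
    rw [← Real.rpow_natCast, ← Real.rpow_mul hn.le]; norm_num
  have hlast : x ^ 12 * y ^ 6 = C ^ 4 / n ^ 2 := by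
    have e : x ^ 12 * y ^ 6 = (x ^ 3) ^ 4 * (y ^ 3) ^ 2 := by ring
    rw [e, hx3, hy3]
    field_simp
  exact ⟨h4, h8, h12, hlast⟩


end Summit.AnomalousDissipation.AnomalousDissipation.Theorems.KolmogorovFloorEnsembleCeiling.Negative
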